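import Summits.CriticalPhenomena.CardyFormulaZ2.Theorems.CardyComplexConeEdgePrecompactUFRSDoublyMarkedLoop

/-!
# Arm domination, the doubly marked residual: the translate's interface loop next to the first stretch
(line `qkz-strip-boundary-arm` of crux `CardyComplexCone.EdgePrecompact`, stmt-CriticalPhenomena-11387;
registered residual sub-goal `ufrs_doublyMarkedCase_cert` of the corrected item (H₁)
`ufrs_armDomination2` of the road map for the uniform forward response stability "UFRS", see the
module docstrings of `…UFRSArmDominationResiduals.lean` and `…UFRSArmDominationFreeTail.lean`;
Part B, importing the loop lemma `translateLoop_DM` of `…UFRSDoublyMarkedLoop.lean`)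

Setting (`ufrsResidualDoublyMarked`): the SPLIT data of `ufrs_failureStructure` for the START
pair `a`, `a'`, the good first stretch `S₀ = O₀ a [0, n]` of the completed configuration
`β₀ = E.bcBondConfig ω` re-entering the ball at `n`, the run `O₁ e [0, T]` of the translate's
completion `β₁ = (shiftData E w).bcBondConfig ω` from the split corner `e = O₀ a m`, leaving the
inner faces of the translate at `T + 1`, and its last contact `O₁ e j = O₀ a i`, `j < T`, with
`S₀`. The named strands at the contact (whisker, outgoing stretch, free tail, return journey) give
only ONE long strand when both marked corners are close; the second long strand is produced here
by a planar-duality argument carried out combinatorially: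

* `translateLoop_DM` (Part A) — the `β₁`-orbit `Λ` of the deep re-entry corner `x₀ = O₀ a n`
  never leaves the inner faces of the translate (an exit happens at THE exit corner of the
  translate, `runEnd_exitType_W3H` + `exitCorner_unique`, which is the end `O₁ a' (k + T)` of the
  translate's exploration; but `x₀` is not on that exploration — its corners have targets off the
  ball or are free-tail corners — and the exploration's start corner is not reached from an inner
  face, `nextCorner_ne_start`), hence, the inner corners being finitely many and the successor map
  injective, `Λ` is PERIODIC and simple over a period `L`.
* Backward agreement: the two dynamics agree off the `3η`-collar (`collarAgreement`), so, read
  backwards from `x₀`, the loop `Λ` coincides with `S₀` down to a corner `O₀ a (s⋆)` whose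
  `β₀`-predecessor `p♭ = O₀ a (s⋆ - 1)` differs from its `β₁`-predecessor `p♯` on `Λ`: the common
  target edge of `p♭`, `p♯` is then a discrepancy edge, `p♭` is a collar corner, and the rest of
  the period, `Λ [1, L - (n - s⋆) - 1]`, is a `β₁`-strand through inner faces of the translate
  from next to the ball back to within one mesh of `p♭`, corner-disjoint from `O₀ a [s⋆, n]`.
* Certificate (`ufrs_doublyMarkedCase_cert`): at the collar point `z = E.δ p♭.1` (or, if that
  strand meets the prefix `O₀ a [0, s⋆)`, at its first contact, again a collar discrepancy) the
  two LONG strands `O₀ a [s⋆, n]` (to the ball) and the `β₁`-strand (from the ball), plus the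
  prefix of `S₀` read back to the start corner `a` at the marked edge `e_a = cSrc a`: FAR if the
  prefix is long, NEAR/MARKED otherwise (`mem_ufrsCert_of_two_far_and_marked_W3H`).

References: S. Smirnov, C. R. Acad. Sci. Paris 333 (2001), §2 (exploration path, its exit at
`e_b`); G. Grimmett, *Percolation* (1999), §11.2; P. Nolin, Electron. J. Probab. 13 (2008), §4.
-/

set_option linter.unusedVariables false

namespace Summit.CriticalPhenomena.CardyFormulaZ2.Cruxes.EdgePrecompact.QkzStripBoundaryArm

open MeasureTheory Filter Set Metric
open scoped Topology BigOperators Pointwise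
open Literature.Probability.LatticeModels Literature.Probability.Percolation
open Literature.Probability.RandomPlanarGeometry (DobrushinDomain)
open Summit.CriticalPhenomena.CardyFormulaZ2.Theses.CardyComplexCone

noncomputable section

/-! ## The doubly marked residual -/

/-- **The doubly marked residual configuration is certified** (registered residual sub-goal
`ufrs_doublyMarkedCase_cert` of stmt-CriticalPhenomena-11387, = `ufrsResidualDoublyMarked`).
DATA: the SPLIT branch of `ufrs_failureStructure` for the START pair (`a`, `a'` the start
corners of `E` and of `shiftData E w`), the good first stretch `O₀ a [0, n]` re-entering the
`2ρ`-deep ball of radius `ρ ≥ 4η` at `n`, the synchronised split corner `e = O₀ a m`, the run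
`O₁ e [0, T]` of the translate's dynamics leaving its inner faces at `T + 1`, its last contact
`O₁ e j = O₀ a i` (`j < T`) with the first stretch, and the two closeness hypotheses of the doubly
marked configuration (unused). CONCLUSION: `ω ∈ ufrsCert E w z (4η) (ρ/2)` at a collar point
`z ∈ D`. PROOF: outside the escape regime, let `Λ` be the `β₁`-orbit of `x₀ = O₀ a n`, a simple
loop through inner faces of the translate (`translateLoop_DM`, Part A: `x₀` is off the translate's
exploration `O₁ a' [0, k + T]`, whose corners have targets off the ball or are free-tail corners).
Read backwards from `x₀`, `Λ` agrees with `O₀ a` down to an index `s⋆ > i` (the contact corner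
`O₀ a i` has different successors in the two dynamics, by freeness of the tail); the
`β₀`-predecessor `O₀ a (s⋆ - 1)` is a collar discrepancy corner and the rest of the period of `Λ`
is a long `β₁`-strand from next to the ball back to within one mesh of it, corner-disjoint from
`O₀ a [s⋆, n]`. If this strand avoids `O₀ a [0, s⋆)`, the point `z = E.δ (O₀ a (s⋆ - 1)).1`
carries two long strands and the prefix `O₀ a [0, s⋆ - 1)` back to the marked edge `cSrc a`
(FAR if long, NEAR/MARKED otherwise, `mem_ufrsCert_of_two_far_and_marked_W3H`); otherwise the same
holds at its first contact with the prefix, again a collar discrepancy corner. -/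
theorem ufrs_doublyMarkedCase_cert : ∀ (D : DobrushinDomain) (η : ℝ), 0 < η → ∃ δ₀ > (0:ℝ), ∀ E : DiscreteDobrushin, E.Ω = D.carrier → E.IsZdAdmissible → E.δ < δ₀ → ∀ (v w : Site 2) (ρ : ℝ), 4 * η ≤ ρ → 2 * ρ ≤ infDist (meshPoint E.δ v) D.carrierᶜ → ‖meshPoint E.δ w‖ < η → ∀ (ω : BondConfig (Site 2)) (a a' : Site 2 × Fin 4) (n m k T j i : ℕ), ((E.IsStartCorner a ∧ (shiftData E w).IsStartCorner a') ∨ (a = a' ∧ medialPoint E.δ (cSrc a) ∈ ball (meshPoint E.δ v) ρ ∧ medialPoint E.δ (cTgt a) ∉ ball (meshPoint E.δ v) ρ)) → (∀ i < n, medialPoint E.δ (cTgt (cornerOrbit (E.bcBondConfig ω) a i)) ∉ ball (meshPoint E.δ v) ρ ∧ E.IsInnerFace (cFace (cornerOrbit (E.bcBondConfig ω) a (i + 1)))) → medialPoint E.δ (cTgt (cornerOrbit (E.bcBondConfig ω) a n)) ∈ ball (meshPoint E.δ v) ρ → m < n → (∀ i < k, medialPoint E.δ (cTgt (cornerOrbit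 ((shiftData E w).bcBondConfig ω) a' i)) ∉ ball (meshPoint E.δ v) ρ ∧ (shiftData E w).IsInnerFace (cFace (cornerOrbit ((shiftData E w).bcBondConfig ω) a' (i + 1)))) → cornerOrbit ((shiftData E w).bcBondConfig ω) a' k = cornerOrbit (E.bcBondConfig ω) a m → ∑ i ∈ Finset.range k, turnOf ((shiftData E w).bcBondConfig ω) (cornerOrbit ((shiftData E w).bcBondConfig ω) a' i) = ∑ i ∈ Finset.range m, turnOf (E.bcBondConfig ω) (cornerOrbit (E.bcBondConfig ω) a i) → infDist (meshPoint E.δ (cornerOrbit (E.bcBondConfig ω) a m).1) D.carrierᶜ < 3 * η → ¬ (cTgt (cornerOrbit (E.bcBondConfig ω) a m) ∈ E.bcBondConfig ω ↔ cTgt (cornerOrbit (E.bcBondConfig ω) a m) ∈ (shiftData E w).bcBondConfig ω) → (∀ j j₀ : ℕ, m < j₀ → j₀ ≤ n → (∀ i < j, medialPoint E.δ (cTgt (cornerOrbit ((shiftData E w).bcBondConfig ω) (cornerOrbit (E.bcBondConfig ω) a m) i)) ∉ ball (meshPoint E.δ v) ρ ∧ (shiftData E w).IsInnerFace (cFace (cornerOrbit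 ((shiftData E w).bcBondConfig ω) (cornerOrbit (E.bcBondConfig ω) a m) (i + 1)))) → cornerOrbit ((shiftData E w).bcBondConfig ω) (cornerOrbit (E.bcBondConfig ω) a m) j = cornerOrbit (E.bcBondConfig ω) a j₀ → ∑ i ∈ Finset.range j, turnOf ((shiftData E w).bcBondConfig ω) (cornerOrbit ((shiftData E w).bcBondConfig ω) (cornerOrbit (E.bcBondConfig ω) a m) i) ≠ ∑ i ∈ Finset.Ico m j₀, turnOf (E.bcBondConfig ω) (cornerOrbit (E.bcBondConfig ω) a i)) → (∀ i < T, medialPoint E.δ (cTgt (cornerOrbit ((shiftData E w).bcBondConfig ω) (cornerOrbit (E.bcBondConfig ω) a m) i)) ∉ ball (meshPoint E.δ v) ρ ∧ (shiftData E w).IsInnerFace (cFace (cornerOrbit ((shiftData E w).bcBondConfig ω) (cornerOrbit (E.bcBondConfig ω) a m) (i + 1)))) → (medialPoint E.δ (cTgt (cornerOrbit ((shiftData E w).bcBondConfig ω) (cornerOrbit (E.bcBondConfig ω) a m) T)) ∈ ball (meshPoint E.δ v) ρ ∨ ¬ (shiftData E w).IsInnerFace (cFace (cornerOrbit ((shiftData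 E w).bcBondConfig ω) (cornerOrbit (E.bcBondConfig ω) a m) (T + 1)))) → j < T → i ≤ n → cornerOrbit ((shiftData E w).bcBondConfig ω) (cornerOrbit (E.bcBondConfig ω) a m) j = cornerOrbit (E.bcBondConfig ω) a i → (∀ j', j < j' → j' ≤ T → ∀ i' ≤ n, cornerOrbit ((shiftData E w).bcBondConfig ω) (cornerOrbit (E.bcBondConfig ω) a m) j' ≠ cornerOrbit (E.bcBondConfig ω) a i') → E.IsStartCorner a → (shiftData E w).IsStartCorner a' → ¬ (shiftData E w).IsInnerFace (cFace (cornerOrbit ((shiftData E w).bcBondConfig ω) (cornerOrbit (E.bcBondConfig ω) a m) (T + 1))) → dist (meshPoint E.δ (cornerOrbit ((shiftData E w).bcBondConfig ω) (cornerOrbit (E.bcBondConfig ω) a m) T).1) (meshPoint E.δ (cornerOrbit (E.bcBondConfig ω) a i).1) < ρ / 2 / 2 → dist (meshPoint E.δ a.1) (meshPoint E.δ (cornerOrbit (E.bcBondConfig ω) a i).1) < ρ / 2 / 2 → ∃ z ∈ D.carrier, infDist z D.carrierᶜ < 3 * η ∧ ω ∈ ufrsCert E w z (4 * η) (ρ /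 2) := by
  classical
  intro D η hη
  obtain ⟨δ₂, hδ₂, hcollar⟩ := collarAgreement D η hη
  refine ⟨min δ₂ η, lt_min hδ₂ hη, ?_⟩
  intro E hEΩ hE hEδ v w ρ hηρ hv hw ω a a' n m k T j i hpair hStr hball hmn hStr₁ hek hsum hcolm hniff hmis hrun hend
    hjT hin hEq hfree ha ha' hout hDF hDW
  have hδ : 0 < E.δ := hE.delta_pos
  have hδ₂' : E.δ < δ₂ := lt_of_lt_of_le hEδ (min_le_left _ _)
  have hδη : E.δ ≤ η := (lt_of_lt_of_le hEδ (min_le_right _ _)).le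
  have hE₁ : (shiftData E w).IsZdAdmissible := isZdAdmissible_shiftData E w hE
  -- the two dynamics agree off the collar; faces at deep vertices are inner for both
  have hagree : ∀ p : Site 2 × Fin 4, 3 * η ≤ infDist (meshPoint E.δ p.1) D.carrierᶜ → (cTgt p ∈ (E.bcBondConfig ω) ↔ cTgt p ∈ ((shiftData E w).bcBondConfig ω)) := by
    rintro ⟨y, kk⟩ hp
    have h := (hcollar E hEΩ hE hδ₂' w hw ω y hp y (by rw [dist_self]; positivity)).1 kk
    exact h.1.trans h.2.symm
  have hcol_of_disc : ∀ p : Site 2 × Fin 4, ¬ (cTgt p ∈ (E.bcBondConfig ω) ↔ cTgt p ∈ ((shiftData E w).bcBondConfig ω)) → infDist (meshPoint E.δ p.1) D.carrierᶜ < 3 * η :=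
    fun p hp => lt_of_not_ge fun h => hp (hagree p h)
  have hinner : ∀ x : Site 2, 3 * η ≤ infDist (meshPoint E.δ x) D.carrierᶜ → ∀ f : Site 2, IsCorner x f → E.IsInnerFace f ∧ (shiftData E w).IsInnerFace f :=
    fun x hx => (hcollar E hEΩ hE hδ₂' w hw ω x hx x (by rw [dist_self]; positivity)).2
  have hfaceE : ∀ t ≤ n, E.IsInnerFace (cFace (cornerOrbit (E.bcBondConfig ω) a t)) := by
    intro t ht
    rcases Nat.eq_zero_or_pos t with rfl | hpos
    · exact ha.isOutEdge.1
    · obtain ⟨t', rfl⟩ : ∃ t', t = t' + 1 := ⟨t - 1, by omega⟩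
      exact (hStr t' (by omega)).2
  have hface₁ : ∀ t, 1 ≤ t → t ≤ T → (shiftData E w).IsInnerFace (cFace (cornerOrbit ((shiftData E w).bcBondConfig ω) (cornerOrbit (E.bcBondConfig ω) a m) t)) := by
    intro t h1 ht
    obtain ⟨t', rfl⟩ : ∃ t', t = t' + 1 := ⟨t - 1, by omega⟩
    exact (hrun t' (by omega)).2
  have hsimple : ∀ s t, s < t → t ≤ n → cornerOrbit (E.bcBondConfig ω) a s ≠ cornerOrbit (E.bcBondConfig ω) a t :=
    fun s t hst htn => cornerOrbit_ne hE ha hst (fun k hk => hfaceE k (by omega))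
  have hzD : ∀ t ≤ n, meshPoint E.δ (cornerOrbit (E.bcBondConfig ω) a t).1 ∈ D.carrier := by
    intro t ht
    rw [← hEΩ]
    exact (ufrs_discrepancyEdges E w ω).2.2 _ (hfaceE t ht)
  have hcola : infDist (meshPoint E.δ a.1) D.carrierᶜ < 3 * η := by
    by_contra h
    rw [not_lt] at h
    exact ha.isOutEdge.2 (hinner a.1 h (faceAt a.1 (a.2 + 3)) (isCorner_faceAt _ _)).1
  -- escape regime
  by_cases hesc : ρ / 2 < 256 * (4 * η)
  · exact ⟨_, hzD 0 (Nat.zero_le _), hcola, mem_ufrsCert_of_lt_W3H hesc⟩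
  rw [not_lt] at hesc
  have hin' : i < n := by
    rcases lt_or_eq_of_le hin with h | h
    · exact h
    · exfalso
      refine (hrun j hjT).1 ?_
      rw [hEq, h]
      exact hball
  -- the deep re-entry corner `x₀ = O₀ a n` and the loop of the translate through it
  have hx₀deep : 3 * η ≤ infDist (meshPoint E.δ (cornerOrbit (E.bcBondConfig ω) a n).1) D.carrierᶜ := deep_of_cTgt_mem_ball_W3H hδ.le hδη hηρ hv hball
  have hdeep₁ : ∀ f, IsCorner (cornerOrbit (E.bcBondConfig ω) a n).1 f → (shiftData E w).IsInnerFace f := fun f hf => (hinner _ hx₀deep f hf).2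
  have hx₀notin : ∀ s ≤ k + T, (cornerOrbit (E.bcBondConfig ω) a n) ≠ cornerOrbit ((shiftData E w).bcBondConfig ω) a' s := by
    intro s hs heq
    rcases Nat.lt_or_ge s k with hsk | hsk
    · exact (hStr₁ s hsk).1 (by rw [← heq]; exact hball)
    · obtain ⟨τ, rfl⟩ : ∃ τ, s = k + τ := ⟨s - k, by omega⟩
      rw [cornerOrbit_add_eq, hek] at heq
      rcases Nat.lt_or_ge τ T with hτ | hτ
      · exact (hrun τ hτ).1 (by rw [← heq]; exact hball)
      · have hτT : τ = T := by omega
        rw [hτT] at heq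
        exact hfree T hjT le_rfl n le_rfl heq.symm
  have hKin : (shiftData E w).IsInnerFace (cFace (cornerOrbit ((shiftData E w).bcBondConfig ω) a' (k + T))) := by
    rw [cornerOrbit_add_eq, hek]
    exact hface₁ T (by omega) le_rfl
  have hKout : ¬ (shiftData E w).IsInnerFace (cFace (cornerOrbit ((shiftData E w).bcBondConfig ω) a' (k + T + 1))) := by
    rw [show k + T + 1 = k + (T + 1) by ring, cornerOrbit_add_eq, hek]
    exact hout
  obtain ⟨hΛin, L, hL0, hΛL, hΛsimple⟩ := translateLoop_DM E hE ω w a' (cornerOrbit (E.bcBondConfig ω) a n) (k + T) ha' hKin hKout hdeep₁ hx₀notin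
  -- backward agreement of the loop with the first stretch, down to the index `n - A = s⋆ > i`
  have hex : ∃ τ, τ ≤ n - 1 - i ∧ nextCorner ((shiftData E w).bcBondConfig ω) (cornerOrbit (E.bcBondConfig ω) a (n - 1 - τ)) ≠ cornerOrbit (E.bcBondConfig ω) a (n - τ) := by
    refine ⟨n - 1 - i, le_rfl, ?_⟩
    rw [show n - 1 - (n - 1 - i) = i by omega, show n - (n - 1 - i) = i + 1 by omega, ← hEq]
    exact hfree (j + 1) (Nat.lt_succ_self j) hjT (i + 1) hin'
  obtain ⟨A, hAle, hAnot, hAmin⟩ : ∃ A, A ≤ n - 1 - i ∧ nextCorner ((shiftData E w).bcBondConfig ω) (cornerOrbit (E.bcBondConfig ω) a (n - 1 - A)) ≠ cornerOrbit (E.bcBondConfig ω) a (n - A) ∧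
      ∀ τ < A, nextCorner ((shiftData E w).bcBondConfig ω) (cornerOrbit (E.bcBondConfig ω) a (n - 1 - τ)) = cornerOrbit (E.bcBondConfig ω) a (n - τ) := by
    refine ⟨Nat.find hex, (Nat.find_spec hex).1, (Nat.find_spec hex).2, fun τ hτ => ?_⟩
    have h := Nat.find_min hex hτ
    push Not at h
    exact h (le_trans hτ.le (Nat.find_spec hex).1)
  have hC : ∀ τ, τ ≤ A → τ ≤ L → cornerOrbit ((shiftData E w).bcBondConfig ω) (cornerOrbit (E.bcBondConfig ω) a n) (L - τ) = cornerOrbit (E.bcBondConfig ω) a (n - τ) := by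
    intro τ
    induction τ with
    | zero =>
      intro _ _
      rw [Nat.sub_zero, Nat.sub_zero]
      exact hΛL
    | succ τ ih =>
      intro hτA hτL
      have h1 := ih (by omega) (by omega)
      have h2 : nextCorner ((shiftData E w).bcBondConfig ω) (cornerOrbit ((shiftData E w).bcBondConfig ω) (cornerOrbit (E.bcBondConfig ω) a n) (L - (τ + 1))) = cornerOrbit (E.bcBondConfig ω) a (n - τ) := by
        rw [← h1]
        show cornerOrbit ((shiftData E w).bcBondConfig ω) (cornerOrbit (E.bcBondConfig ω) a n) (L - (τ + 1) + 1) = cornerOrbit ((shiftData E w).bcBondConfig ω) (cornerOrbit (E.bcBondConfig ω) a n) (L - τ)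
        rw [show L - (τ + 1) + 1 = L - τ by omega]
      have h3 : nextCorner ((shiftData E w).bcBondConfig ω) (cornerOrbit (E.bcBondConfig ω) a (n - (τ + 1))) = cornerOrbit (E.bcBondConfig ω) a (n - τ) := by
        rw [show n - (τ + 1) = n - 1 - τ by omega]
        exact hAmin τ (by omega)
      exact nextCorner_injective (h2.trans h3.symm)
  have hAL : A < L := by
    by_contra h
    rw [not_lt] at h
    have h1 := hC L h le_rfl
    rw [Nat.sub_self] at h1
    exact hsimple (n - L) n (by omega) le_rfl h1.symm
  -- the departure: `p♭ = O₀ a jb`, `jb = n - 1 - A`; its successor `O₀ a (jb + 1)` has the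
  -- `β₁`-predecessor `p♯ = Λ (L - A - 1) ≠ p♭`, so `cTgt p♭` is a discrepancy edge
  obtain ⟨jb, hjb⟩ : ∃ jb, jb = n - 1 - A := ⟨_, rfl⟩
  have hjb1 : jb + 1 = n - A := by omega
  have hjbn : jb < n := by omega
  rw [← hjb] at hAnot
  have hpsharp : nextCorner ((shiftData E w).bcBondConfig ω) (cornerOrbit ((shiftData E w).bcBondConfig ω) (cornerOrbit (E.bcBondConfig ω) a n) (L - A - 1)) = cornerOrbit (E.bcBondConfig ω) a (jb + 1) := by
    rw [hjb1, ← hC A le_rfl hAL.le]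
    show cornerOrbit ((shiftData E w).bcBondConfig ω) (cornerOrbit (E.bcBondConfig ω) a n) (L - A - 1 + 1) = cornerOrbit ((shiftData E w).bcBondConfig ω) (cornerOrbit (E.bcBondConfig ω) a n) (L - A)
    rw [show L - A - 1 + 1 = L - A by omega]
  have hne : cornerOrbit ((shiftData E w).bcBondConfig ω) (cornerOrbit (E.bcBondConfig ω) a n) (L - A - 1) ≠ cornerOrbit (E.bcBondConfig ω) a jb := by
    intro h
    apply hAnot
    rw [← hjb1, ← h]
    exact hpsharp
  have hdisc : ¬ (cTgt (cornerOrbit (E.bcBondConfig ω) a jb) ∈ (E.bcBondConfig ω) ↔ cTgt (cornerOrbit (E.bcBondConfig ω) a jb) ∈ ((shiftData E w).bcBondConfig ω)) := by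
    intro hiff
    apply hne
    apply nextCorner_injective (β := ((shiftData E w).bcBondConfig ω))
    rw [hpsharp, ← nextCorner_congr_of_iff hiff]
    rfl
  have hcolb : infDist (meshPoint E.δ (cornerOrbit (E.bcBondConfig ω) a jb).1) D.carrierᶜ < 3 * η := hcol_of_disc _ hdisc
  have hsharp_near : dist (meshPoint E.δ (cornerOrbit ((shiftData E w).bcBondConfig ω) (cornerOrbit (E.bcBondConfig ω) a n) (L - A - 1)).1) (meshPoint E.δ (cornerOrbit (E.bcBondConfig ω) a jb).1) ≤ E.δ := by
    apply dist_meshPoint_le_of_mem_cTgt_DM hδ.le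
    have h1 : cTgt (cornerOrbit ((shiftData E w).bcBondConfig ω) (cornerOrbit (E.bcBondConfig ω) a n) (L - A - 1)) = cTgt (cornerOrbit (E.bcBondConfig ω) a jb) := by
      rw [← cSrc_nextCorner (β := ((shiftData E w).bcBondConfig ω)) (cornerOrbit ((shiftData E w).bcBondConfig ω) (cornerOrbit (E.bcBondConfig ω) a n) (L - A - 1)), hpsharp, ← cSrc_nextCorner (β := (E.bcBondConfig ω)) (cornerOrbit (E.bcBondConfig ω) a jb)]
      rfl
    rw [← h1]
    exact Sym2.mem_mk_left _ _
  -- far ends: next to the ball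
  have hfar : ∀ (c y : Site 2), infDist (meshPoint E.δ c) D.carrierᶜ < 3 * η → dist (meshPoint E.δ y) (meshPoint E.δ (cornerOrbit (E.bcBondConfig ω) a n).1) ≤ E.δ →
      ρ / 2 / 2 ≤ dist (meshPoint E.δ y) (meshPoint E.δ c) := by
    intro c y hc hy
    have := far_of_near_cTgt_mem_ball_W3H hδ.le hv hc (z := meshPoint E.δ c) (s := 0) (by rw [dist_self]) hball hy
    linarith
  have hΛ1near : dist (meshPoint E.δ (cornerOrbit ((shiftData E w).bcBondConfig ω) (cornerOrbit (E.bcBondConfig ω) a n) 1).1) (meshPoint E.δ (cornerOrbit (E.bcBondConfig ω) a n).1) ≤ E.δ := by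
    have h := dist_meshPoint_cornerOrbit_succ_le ((shiftData E w).bcBondConfig ω) (cornerOrbit (E.bcBondConfig ω) a n) E.δ 0
    rwa [abs_of_pos hδ] at h
  have hx₀self : dist (meshPoint E.δ (cornerOrbit (E.bcBondConfig ω) a n).1) (meshPoint E.δ (cornerOrbit (E.bcBondConfig ω) a n).1) ≤ E.δ := by
    rw [dist_self]; exact hδ.le
  -- the strand `Λ [1, L - A - 1]` misses `O₀ a [jb + 1, n]` (simplicity of the period)
  have hperiod : ∀ t, 1 ≤ t → t ≤ L - A - 1 → ∀ u, jb + 1 ≤ u → u ≤ n → cornerOrbit ((shiftData E w).bcBondConfig ω) (cornerOrbit (E.bcBondConfig ω) a n) t ≠ cornerOrbit (E.bcBondConfig ω) a u := by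
    intro t ht1 ht u hu1 hun h
    have hC' := hC (n - u) (by omega) (by omega)
    rw [show n - (n - u) = u by omega] at hC'
    rcases Nat.eq_zero_or_pos (n - u) with h0 | hpos
    · rw [h0, Nat.sub_zero, hΛL] at hC'
      exact hΛsimple 0 t (by omega) (by omega) (hC'.trans h.symm)
    · exact hΛsimple t (L - (n - u)) (by omega) (by omega) (h.trans hC'.symm)
  -- assembling the certificate at a collar corner `O₀ a r` of the first stretch next to which a
  -- `β₁`-strand `Λ [1, ℓ]` from the ball ends, corner-disjoint from the whole first stretch
  have key : ∀ (r ℓ : ℕ), r < n → 1 ≤ ℓ → ℓ < L →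
      infDist (meshPoint E.δ (cornerOrbit (E.bcBondConfig ω) a r).1) D.carrierᶜ < 3 * η →
      dist (meshPoint E.δ (cornerOrbit ((shiftData E w).bcBondConfig ω) (cornerOrbit (E.bcBondConfig ω) a n) ℓ).1) (meshPoint E.δ (cornerOrbit (E.bcBondConfig ω) a r).1) ≤ E.δ →
      (∀ t, 1 ≤ t → t ≤ ℓ → ∀ u ≤ n, cornerOrbit ((shiftData E w).bcBondConfig ω) (cornerOrbit (E.bcBondConfig ω) a n) t ≠ cornerOrbit (E.bcBondConfig ω) a u) →
      ∃ z ∈ D.carrier, infDist z D.carrierᶜ < 3 * η ∧ ω ∈ ufrsCert E w z (4 * η) (ρ / 2) := by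
    intro r ℓ hrn hℓ1 hℓL hcolr hnear hdisj
    refine ⟨meshPoint E.δ (cornerOrbit (E.bcBondConfig ω) a r).1, hzD r hrn.le, hcolr, ?_⟩
    have hδ4 : E.δ ≤ 4 * η := by linarith
    have hS1near : dist (meshPoint E.δ (cornerOrbit (E.bcBondConfig ω) a (r + 1)).1) (meshPoint E.δ (cornerOrbit (E.bcBondConfig ω) a r).1) ≤ 4 * η := by
      have h := dist_meshPoint_cornerOrbit_succ_le (E.bcBondConfig ω) a E.δ r
      rw [abs_of_pos hδ] at h
      linarith
    have hS1 : ∀ R' : ℝ, R' ≤ ρ / 2 / 2 → (r + 1) ≤ n ∧ ((dist (meshPoint E.δ (cornerOrbit (E.bcBondConfig ω) a (r + 1)).1) (meshPoint E.δ (cornerOrbit (E.bcBondConfig ω) a r).1) ≤ (4 * η) ∧ R' ≤ dist (meshPoint E.δ (cornerOrbit (E.bcBondConfig ω) a n).1) (meshPoint E.δ (cornerOrbit (E.bcBondConfig ω) a r).1)) ∨ (R' ≤ dist (meshPoint E.δ (cornerOrbit (E.bcBondConfig ω) a (r + 1)).1) (meshPoint E.δ (cornerOrbit (E.bcBondConfig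 ω) a r).1) ∧ dist (meshPoint E.δ (cornerOrbit (E.bcBondConfig ω) a n).1) (meshPoint E.δ (cornerOrbit (E.bcBondConfig ω) a r).1) ≤ (4 * η))) ∧ (∀ t, (r + 1) ≤ t → t ≤ n → E.IsInnerFace (cFace (cornerOrbit (E.bcBondConfig ω) a t))) ∧ (∀ s t, (r + 1) ≤ s → s < t → t ≤ n → cornerOrbit (E.bcBondConfig ω) a s ≠ cornerOrbit (E.bcBondConfig ω) a t) :=
      fun R' hR' => ⟨hrn, Or.inl ⟨hS1near, hR'.trans (hfar _ _ hcolr hx₀self)⟩, fun t _ ht => hfaceE t ht, fun s t _ hst htn => hsimple s t hst htn⟩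
    have hS2 : ∀ R' : ℝ, R' ≤ ρ / 2 / 2 → 1 ≤ ℓ ∧ ((dist (meshPoint E.δ (cornerOrbit ((shiftData E w).bcBondConfig ω) (cornerOrbit (E.bcBondConfig ω) a n) 1).1) (meshPoint E.δ (cornerOrbit (E.bcBondConfig ω) a r).1) ≤ (4 * η) ∧ R' ≤ dist (meshPoint E.δ (cornerOrbit ((shiftData E w).bcBondConfig ω) (cornerOrbit (E.bcBondConfig ω) a n) ℓ).1) (meshPoint E.δ (cornerOrbit (E.bcBondConfig ω) a r).1)) ∨ (R' ≤ dist (meshPoint E.δ (cornerOrbit ((shiftData E w).bcBondConfig ω) (cornerOrbit (E.bcBondConfig ω) a n) 1).1) (meshPoint E.δ (cornerOrbit (E.bcBondConfig ω) a r).1) ∧ dist (meshPoint E.δ (cornerOrbit ((shiftData E w).bcBondConfig ω) (cornerOrbit (E.bcBondConfig ω) a n) ℓ).1) (meshPoint E.δ (cornerOrbit (E.bcBondConfig ω) a r).1) ≤ (4 * η))) ∧ (∀ t, 1 ≤ t → t ≤ ℓ → (shiftData E w).IsInnerFace (cFace (cornerOrbit ((shiftData E w).bcBondConfig ω) (cornerOrbit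 (E.bcBondConfig ω) a n) t))) ∧ (∀ s t, 1 ≤ s → s < t → t ≤ ℓ → cornerOrbit ((shiftData E w).bcBondConfig ω) (cornerOrbit (E.bcBondConfig ω) a n) s ≠ cornerOrbit ((shiftData E w).bcBondConfig ω) (cornerOrbit (E.bcBondConfig ω) a n) t) :=
      fun R' hR' => ⟨hℓ1, Or.inr ⟨hR'.trans (hfar _ _ hcolr hΛ1near), hnear.trans hδ4⟩, fun t _ _ => hΛin t, fun s t _ hst htl => hΛsimple s t hst (by omega)⟩
    have hS12 : ∀ s t, (r + 1) ≤ s → s ≤ n → 1 ≤ t → t ≤ ℓ → cornerOrbit (E.bcBondConfig ω) a s ≠ cornerOrbit ((shiftData E w).bcBondConfig ω) (cornerOrbit (E.bcBondConfig ω) a n) t :=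
      fun s t _ hsn ht1 htl h => hdisj t ht1 htl s hsn h.symm
    have hmk : ∀ X : ℝ, dist (meshPoint E.δ a.1) (meshPoint E.δ (cornerOrbit (E.bcBondConfig ω) a r).1) ≤ X → ∃ e₀ : Sym2 (Site 2), (e₀ ∈ E.zdABEdges ∨ e₀ ∈ (shiftData E w).zdABEdges) ∧
        dist (medialPoint E.δ e₀) (meshPoint E.δ (cornerOrbit (E.bcBondConfig ω) a r).1) ≤ X + E.δ := by
      intro X hX
      refine ⟨cSrc a, Or.inl (DiscreteDobrushin.cSrc_mem_zdABEdges ha.mem_zdArcA ha.mem_zdArcB (Or.inl ha.isOutEdge)), ?_⟩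
      have h1 := dist_medialPoint_cSrc_le' hδ.le a
      have h2 := dist_triangle (medialPoint E.δ (cSrc a)) (meshPoint E.δ a.1) (meshPoint E.δ (cornerOrbit (E.bcBondConfig ω) a r).1)
      linarith
    rcases Nat.eq_zero_or_pos r with hr0 | hrpos
    · -- the collar corner is the start corner: the marked edge `cSrc a` is at `z`
      subst hr0
      have hX0 : dist (meshPoint E.δ a.1) (meshPoint E.δ (cornerOrbit (E.bcBondConfig ω) a 0).1) ≤ 0 := by
        show dist (meshPoint E.δ a.1) (meshPoint E.δ a.1) ≤ 0
        rw [dist_self]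
      have hXlt : (0:ℝ) < ρ / 2 / 2 := by linarith
      exact mem_ufrsCert_of_two_far_and_marked_W3H true false true a (cornerOrbit (E.bcBondConfig ω) a n) a (0 + 1) n 1 ℓ 0 0 hη hδη hXlt (hmk 0 hX0) hS1 hS2 hS12
        (fun hbig => False.elim (by linarith))
    · -- the prefix `O₀ a [0, r - 1]`, read back to the start corner
      have hS3near : dist (meshPoint E.δ (cornerOrbit (E.bcBondConfig ω) a (r - 1)).1) (meshPoint E.δ (cornerOrbit (E.bcBondConfig ω) a r).1) ≤ 4 * η := by
        have h := dist_meshPoint_cornerOrbit_succ_le (E.bcBondConfig ω) a E.δ (r - 1)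
        rw [abs_of_pos hδ, Nat.sub_add_cancel hrpos, dist_comm] at h
        linarith
      have hS3 : ∀ R' : ℝ, R' ≤ dist (meshPoint E.δ a.1) (meshPoint E.δ (cornerOrbit (E.bcBondConfig ω) a r).1) → 0 ≤ (r - 1) ∧ ((dist (meshPoint E.δ (cornerOrbit (E.bcBondConfig ω) a 0).1) (meshPoint E.δ (cornerOrbit (E.bcBondConfig ω) a r).1) ≤ (4 * η) ∧ R' ≤ dist (meshPoint E.δ (cornerOrbit (E.bcBondConfig ω) a (r - 1)).1) (meshPoint E.δ (cornerOrbit (E.bcBondConfig ω) a r).1)) ∨ (R' ≤ dist (meshPoint E.δ (cornerOrbit (E.bcBondConfig ω) a 0).1) (meshPoint E.δ (cornerOrbit (E.bcBondConfig ω) a r).1) ∧ dist (meshPoint E.δ (cornerOrbit (E.bcBondConfig ω) a (r - 1)).1) (meshPoint E.δ (cornerOrbit (E.bcBondConfig ω) a r).1) ≤ (4 * η))) ∧ (∀ t, 0 ≤ t → t ≤ (r - 1) → E.IsInnerFace (cFace (cornerOrbit (E.bcBondConfig ω) a t))) ∧ (∀ s t, 0 ≤ s → s < t → t ≤ (r -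 1) → cornerOrbit (E.bcBondConfig ω) a s ≠ cornerOrbit (E.bcBondConfig ω) a t) :=
        fun R' hR' => ⟨Nat.zero_le _, Or.inr ⟨hR', hS3near⟩, fun t _ ht => hfaceE t (by omega), fun s t _ hst ht => hsimple s t hst (by omega)⟩
      have hS13 : ∀ s t, (r + 1) ≤ s → s ≤ n → 0 ≤ t → t ≤ (r - 1) → cornerOrbit (E.bcBondConfig ω) a s ≠ cornerOrbit (E.bcBondConfig ω) a t :=
        fun s t hs hsn _ ht h => hsimple t s (by omega) hsn h.symm
      have hS23 : ∀ s t, 1 ≤ s → s ≤ ℓ → 0 ≤ t → t ≤ (r - 1) → cornerOrbit ((shiftData E w).bcBondConfig ω) (cornerOrbit (E.bcBondConfig ω) a n) s ≠ cornerOrbit (E.bcBondConfig ω) a t :=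
        fun s t hs hsl _ ht => hdisj s hs hsl t (by omega)
      by_cases hXfar : ρ / 2 / 2 ≤ dist (meshPoint E.δ a.1) (meshPoint E.δ (cornerOrbit (E.bcBondConfig ω) a r).1)
      · exact mem_ufrsCert_of_three_far_W3H true false true a (cornerOrbit (E.bcBondConfig ω) a n) a (r + 1) n 1 ℓ 0 (r - 1) hη hesc (hS1 _ le_rfl) (hS2 _ le_rfl)
          (hS3 _ hXfar) hS12 hS13 hS23
      · rw [not_le] at hXfar
        exact mem_ufrsCert_of_two_far_and_marked_W3H true false true a (cornerOrbit (E.bcBondConfig ω) a n) a (r + 1) n 1 ℓ 0 (r - 1) hη hδη hXfar (hmk _ le_rfl)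
          hS1 hS2 hS12 (fun _ => ⟨hS3 _ le_rfl, hS13, hS23⟩)
  -- case analysis: does the `β₁`-strand `Λ [1, L - A - 1]` meet the prefix `O₀ a [0, jb]`?
  by_cases hcontact : ∃ t, (1 ≤ t ∧ t ≤ L - A - 1) ∧ ∃ u, u ≤ jb ∧ cornerOrbit ((shiftData E w).bcBondConfig ω) (cornerOrbit (E.bcBondConfig ω) a n) t = cornerOrbit (E.bcBondConfig ω) a u
  · -- first contact `Λ ℓ = O₀ a u`
    obtain ⟨ℓ, ⟨hℓ1, hℓle⟩, ⟨u, hujb, hcu⟩, hmin⟩ : ∃ ℓ, (1 ≤ ℓ ∧ ℓ ≤ L - A - 1) ∧ (∃ u, u ≤ jb ∧ cornerOrbit ((shiftData E w).bcBondConfig ω) (cornerOrbit (E.bcBondConfig ω) a n) ℓ = cornerOrbit (E.bcBondConfig ω) a u) ∧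
        ∀ t, 1 ≤ t → t < ℓ → ∀ u' ≤ jb, cornerOrbit ((shiftData E w).bcBondConfig ω) (cornerOrbit (E.bcBondConfig ω) a n) t ≠ cornerOrbit (E.bcBondConfig ω) a u' := by
      refine ⟨Nat.find hcontact, (Nat.find_spec hcontact).1, (Nat.find_spec hcontact).2, fun t ht1 htℓ u' hu' h => ?_⟩
      exact Nat.find_min hcontact htℓ ⟨⟨ht1, le_trans htℓ.le (Nat.find_spec hcontact).1.2⟩, u', hu', h⟩
    have hdisj : ∀ t, 1 ≤ t → t ≤ ℓ - 1 → ∀ u' ≤ n, cornerOrbit ((shiftData E w).bcBondConfig ω) (cornerOrbit (E.bcBondConfig ω) a n) t ≠ cornerOrbit (E.bcBondConfig ω) a u' := by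
      intro t ht1 ht u' hu'n
      rcases le_or_gt u' jb with h | h
      · exact hmin t ht1 (by omega) u' h
      · exact hperiod t ht1 (by omega) u' (by omega) hu'n
    have hsucc : nextCorner ((shiftData E w).bcBondConfig ω) (cornerOrbit ((shiftData E w).bcBondConfig ω) (cornerOrbit (E.bcBondConfig ω) a n) (ℓ - 1)) = cornerOrbit (E.bcBondConfig ω) a u := by
      rw [← hcu]
      show cornerOrbit ((shiftData E w).bcBondConfig ω) (cornerOrbit (E.bcBondConfig ω) a n) (ℓ - 1 + 1) = cornerOrbit ((shiftData E w).bcBondConfig ω) (cornerOrbit (E.bcBondConfig ω) a n) ℓ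
      rw [Nat.sub_add_cancel hℓ1]
    rcases Nat.eq_zero_or_pos u with hu0 | hupos
    · -- contact at the start corner itself
      rw [hu0] at hsucc
      have hnear : dist (meshPoint E.δ (cornerOrbit ((shiftData E w).bcBondConfig ω) (cornerOrbit (E.bcBondConfig ω) a n) (ℓ - 1)).1) (meshPoint E.δ (cornerOrbit (E.bcBondConfig ω) a 0).1) ≤ E.δ := by
        apply dist_meshPoint_le_of_mem_cSrc_DM hδ.le
        rw [← hsucc, cSrc_nextCorner]
        exact Sym2.mem_mk_left _ _
      have hℓ2 : 2 ≤ ℓ := by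
        by_contra h
        have h1 : ℓ = 1 := by omega
        have h2 := hfar _ _ hcola hx₀self
        rw [h1] at hnear
        have h3 : dist (meshPoint E.δ (cornerOrbit (E.bcBondConfig ω) a n).1) (meshPoint E.δ a.1) ≤ E.δ := hnear
        linarith
      exact key 0 (ℓ - 1) (by omega) (by omega) (by omega) hcola hnear hdisj
    · -- contact at `O₀ a u`, `u ≥ 1`: the collar corner is `O₀ a (u - 1)`
      have hsucc₀ : nextCorner (E.bcBondConfig ω) (cornerOrbit (E.bcBondConfig ω) a (u - 1)) = cornerOrbit (E.bcBondConfig ω) a u := by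
        show cornerOrbit (E.bcBondConfig ω) a (u - 1 + 1) = cornerOrbit (E.bcBondConfig ω) a u
        rw [Nat.sub_add_cancel hupos]
      have hne' : cornerOrbit ((shiftData E w).bcBondConfig ω) (cornerOrbit (E.bcBondConfig ω) a n) (ℓ - 1) ≠ cornerOrbit (E.bcBondConfig ω) a (u - 1) := by
        intro h
        rcases Nat.lt_or_ge 1 ℓ with h2 | h2
        · exact hmin (ℓ - 1) (by omega) (by omega) (u - 1) (by omega) h
        · have h1 : ℓ = 1 := by omega
          rw [h1] at h
          exact hsimple (u - 1) n (by omega) le_rfl h.symm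
      have hdisc' : ¬ (cTgt (cornerOrbit (E.bcBondConfig ω) a (u - 1)) ∈ (E.bcBondConfig ω) ↔ cTgt (cornerOrbit (E.bcBondConfig ω) a (u - 1)) ∈ ((shiftData E w).bcBondConfig ω)) := by
        intro hiff
        apply hne'
        apply nextCorner_injective (β := ((shiftData E w).bcBondConfig ω))
        rw [hsucc, ← nextCorner_congr_of_iff hiff, hsucc₀]
      have hcold : infDist (meshPoint E.δ (cornerOrbit (E.bcBondConfig ω) a (u - 1)).1) D.carrierᶜ < 3 * η := hcol_of_disc _ hdisc'
      have hnear : dist (meshPoint E.δ (cornerOrbit ((shiftData E w).bcBondConfig ω) (cornerOrbit (E.bcBondConfig ω) a n) (ℓ - 1)).1) (meshPoint E.δ (cornerOrbit (E.bcBondConfig ω) a (u - 1)).1) ≤ E.δ := by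
        apply dist_meshPoint_le_of_mem_cTgt_DM hδ.le
        have h1 : cTgt (cornerOrbit ((shiftData E w).bcBondConfig ω) (cornerOrbit (E.bcBondConfig ω) a n) (ℓ - 1)) = cTgt (cornerOrbit (E.bcBondConfig ω) a (u - 1)) := by
          rw [← cSrc_nextCorner (β := ((shiftData E w).bcBondConfig ω)) (cornerOrbit ((shiftData E w).bcBondConfig ω) (cornerOrbit (E.bcBondConfig ω) a n) (ℓ - 1)), hsucc, ← hsucc₀, cSrc_nextCorner]
        rw [← h1]
        exact Sym2.mem_mk_left _ _
      have hℓ2 : 2 ≤ ℓ := by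
        by_contra h
        have h1 : ℓ = 1 := by omega
        have h2 := hfar _ _ hcold hx₀self
        rw [h1] at hnear
        have h3 : dist (meshPoint E.δ (cornerOrbit (E.bcBondConfig ω) a n).1) (meshPoint E.δ (cornerOrbit (E.bcBondConfig ω) a (u - 1)).1) ≤ E.δ := hnear
        linarith
      exact key (u - 1) (ℓ - 1) (by omega) (by omega) (by omega) hcold hnear hdisj
  · -- no contact: the collar corner is `p♭ = O₀ a jb`
    push Not at hcontact
    have hdisj : ∀ t, 1 ≤ t → t ≤ L - A - 1 → ∀ u' ≤ n, cornerOrbit ((shiftData E w).bcBondConfig ω) (cornerOrbit (E.bcBondConfig ω) a n) t ≠ cornerOrbit (E.bcBondConfig ω) a u' := by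
      intro t ht1 ht u' hu'n
      rcases le_or_gt u' jb with h | h
      · exact hcontact t ⟨ht1, ht⟩ u' h
      · exact hperiod t ht1 ht u' (by omega) hu'n
    have hℓ1 : 1 ≤ L - A - 1 := by
      by_contra h
      have h0 : L - A - 1 = 0 := by omega
      rw [h0] at hsharp_near
      have h2 := hfar _ _ hcolb hx₀self
      have h3 : dist (meshPoint E.δ (cornerOrbit (E.bcBondConfig ω) a n).1) (meshPoint E.δ (cornerOrbit (E.bcBondConfig ω) a jb).1) ≤ E.δ := hsharp_near
      linarith
    exact key jb (L - A - 1) hjbn hℓ1 (by omega) hcolb hsharp_near hdisj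

end

end Summit.CriticalPhenomena.CardyFormulaZ2.Cruxes.EdgePrecompact.QkzStripBoundaryArm
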